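import Summits.RiemannHypothesis.RiemannHypothesis.Theses.RuelleBand

/-!
# RiemannHypothesis / RuelleBand — support item `AsymptoticToCofinite` (glue rung #4 → #5):
# the exact content of the rung, kernel-checked

Route `RiemannHypothesis/RuelleBand`, item stmt-RiemannHypothesis-14745 (`AsymptoticToCofinite`,
support, rank 9):

  `AsymptoticCriticalLine → CofiniteCriticalLine`

("if for every `ε > 0` only finitely many zeros of `ζ` in the open strip lie `≥ ε` off the critical
line, then only finitely many zeros of the open strip lie off the line at all").

This file does NOT settle the item. The item is OPEN: it is implied by the Riemann Hypothesis
(`ruelleBand_asymptoticToCofinite_of_riemannHypothesis`), it is not a consequence of anything in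
print, and it is false exactly in the scenario "rung #4 holds while infinitely many off-line zeros
converge to the critical line" (`ruelleBand_not_asymptoticToCofinite_iff`), which no theorem in
print excludes or produces. What the file records, as lemmas attached to the item, is the exact
content of the rung in three equivalent readings:

* `ruelleBand_asymptoticToCofinite_iff_lineRepulsion` — GIVEN rung #4, rung #5 is exactly
  FIXED-WIDTH REPULSION from the critical line: `∃ δ > 0`, no zero `s` of the open strip has
  `0 < |Re s − 1/2| < δ`. Unconditionally `CofiniteCriticalLine →` repulsion (minimum over the finite
  exceptional set, `ruelleBand_lineRepulsion_of_cofiniteCriticalLine`), and repulsion at width `δ`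
  together with rung #4 at `ε = δ` gives rung #5 (`ruelleBand_cofiniteCriticalLine_of_lineRepulsion`).
* `ruelleBand_asymptoticToCofinite_iff_eventualRepulsion` — the same with repulsion required only
  above some height `T` (the zeros of `ζ` of bounded height in the closed strip are finitely many:
  Mathlib `IsCompact.inter_riemannZetaZeros_finite`). This is the form in which a "repulsion tube"
  would enter; `ruelleBand_cofiniteCriticalLine_of_rate_lt_width` states the race exactly: a
  concentration RATE `η` for the zeros (a quantitative rung #4) and a repulsion WIDTH `w` with
  `η < w` above some height give rung #5. Every tube width on record is `0` (no repulsion-from-the-line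
  theorem exists) and the carded one (idea card critical-line-repulsion-tube) is `c / log γ → 0`, while
  no rate `η → 0` is known either: both inputs of the race are open.
* `ruelleBand_not_asymptoticToCofinite_iff` and `ruelleBand_exists_offLine_near_line_above` — the
  failure shape: the item fails iff rung #4 holds with an INFINITE exceptional set, and then for every
  `ε > 0` and every height `T` there is an off-line zero of the open strip within `ε` of the line and
  above height `T` (the exceptional zeros converge to the line and escape to infinite height).
* `ruelleBand_asymptoticToCofinite_of_riemannHypothesis` / `ruelleBand_not_riemannHypothesis_of_not_asymptoticToCofinite`
  — the item is RH-implied: a refutation of it is a disproof of RH. It is NOT RH-equivalent: it also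
  holds whenever rung #4 fails (`ruelleBand_asymptoticToCofinite_of_not_asymptoticCriticalLine`) or
  rung #5 holds (`ruelleBand_asymptoticToCofinite_of_cofiniteCriticalLine`).

The SHAPE of the implication is false for abstract point sets (tree:
`Summit.RiemannHypothesis.Cruxes.CofiniteCriticalLine.Negative.not_abstract_asymptotic_imp_cofinite`,
witness `{1/2 + 1/(n+2) + n i}`), so any proof must use `ζ` beyond the discreteness of its zeros;
nothing of the kind is used (or available) here. No named facts; the cone is that of the route file.
-/

-- D-0017: a single-problem summit has `RiemannHypothesis.RiemannHypothesis` in every name by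
-- design; the lakefile turns this linter off for `Summits`; repeated here so that standalone
-- elaboration is warning-free as well.
set_option linter.dupNamespace false

namespace Summit.RiemannHypothesis.RiemannHypothesis.Theorems

open Summit.RiemannHypothesis.RiemannHypothesis.Theses.RuelleBand

/-! ## 1. Truth-table position: RH-implied, implied by rung #5, implied by the failure of rung #4 -/

/-- Rung #5 trivially gives the glue rung `AsymptoticToCofinite` (the conclusion holds outright).
[folklore] -/
theorem ruelleBand_asymptoticToCofinite_of_cofiniteCriticalLine (hC : CofiniteCriticalLine) :
    AsymptoticToCofinite := fun _ => hC

/-- The failure of rung #4 trivially gives the glue rung `AsymptoticToCofinite` (the hypothesis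
fails). In particular the item is NOT equivalent to RH. [folklore] -/
theorem ruelleBand_asymptoticToCofinite_of_not_asymptoticCriticalLine (h4 : ¬ AsymptoticCriticalLine) :
    AsymptoticToCofinite := fun h => absurd h h4

/-- Under Mathlib's `RiemannHypothesis` the exceptional set of rung #5 is empty: a zero of the open
strip is neither trivial (`Re (-2(n+1)) ≤ 0`) nor the pole `s = 1`, so RH puts it on the line.
[folklore] -/
theorem ruelleBand_cofiniteCriticalLine_of_riemannHypothesis' (hRH : RiemannHypothesis) :
    CofiniteCriticalLine := by
  unfold CofiniteCriticalLine
  refine Set.finite_empty.subset ?_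
  rintro s ⟨hz, h0, h1, hne⟩
  refine (hne (hRH s hz ?_ ?_)).elim
  · rintro ⟨n, hn⟩
    have hre := congrArg Complex.re hn
    have hcast : (-2 * ((n : ℂ) + 1)) = ((-2 * ((n : ℝ) + 1) : ℝ) : ℂ) := by push_cast; ring
    rw [hcast, Complex.ofReal_re] at hre
    have : (0 : ℝ) ≤ n := n.cast_nonneg
    linarith
  · rintro rfl
    norm_num at h1

/-- **The item is RH-implied**: `RiemannHypothesis → AsymptoticToCofinite`. [folklore] -/
theorem ruelleBand_asymptoticToCofinite_of_riemannHypothesis (hRH : RiemannHypothesis) :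
    AsymptoticToCofinite :=
  ruelleBand_asymptoticToCofinite_of_cofiniteCriticalLine
    (ruelleBand_cofiniteCriticalLine_of_riemannHypothesis' hRH)

/-- Contrapositive: a refutation of the glue rung is a disproof of the Riemann Hypothesis (and of the
summit statement, which is definitionally Mathlib's `RiemannHypothesis`). [folklore] -/
theorem ruelleBand_not_riemannHypothesis_of_not_asymptoticToCofinite (h : ¬ AsymptoticToCofinite) :
    ¬ RiemannHypothesis :=
  mt ruelleBand_asymptoticToCofinite_of_riemannHypothesis h

/-! ## 2. Given rung #4, rung #5 is exactly fixed-width repulsion from the critical line -/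

/-- Rung #5 gives FIXED-WIDTH REPULSION from the line: some `δ > 0` such that no zero of the open strip
has `0 < |Re s − 1/2| < δ` (take the minimum of `|Re s − 1/2|` over the finite exceptional set, or
`δ = 1` if it is empty). [folklore] -/
theorem ruelleBand_lineRepulsion_of_cofiniteCriticalLine (hC : CofiniteCriticalLine) :
    ∃ δ : ℝ, 0 < δ ∧ ∀ s : ℂ, riemannZeta s = 0 → 0 < s.re → s.re < 1 →
      |s.re - 1 / 2| < δ → s.re = 1 / 2 := by
  by_cases hne : ({s : ℂ | riemannZeta s = 0 ∧ 0 < s.re ∧ s.re < 1 ∧ s.re ≠ 1 / 2} : Set ℂ).Nonempty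
  · obtain ⟨a, ha, hmin⟩ :=
      Set.exists_min_image _ (fun s : ℂ => |s.re - 1 / 2|) hC hne
    refine ⟨|a.re - 1 / 2|, abs_pos.2 (sub_ne_zero.2 ha.2.2.2), fun s hz h0 h1 hlt => ?_⟩
    by_contra hs
    exact (not_le.2 hlt) (hmin s ⟨hz, h0, h1, hs⟩)
  · refine ⟨1, one_pos, fun s hz h0 h1 _ => ?_⟩
    by_contra hs
    exact hne ⟨s, hz, h0, h1, hs⟩

/-- Repulsion at width `δ` plus rung #4 at level `ε = δ` gives rung #5: an off-line zero of the open
strip is then at distance `≥ δ` from the line, and there are finitely many such. [folklore] -/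
theorem ruelleBand_cofiniteCriticalLine_of_lineRepulsion (h4 : AsymptoticCriticalLine) {δ : ℝ}
    (hδ : 0 < δ)
    (hrep : ∀ s : ℂ, riemannZeta s = 0 → 0 < s.re → s.re < 1 → |s.re - 1 / 2| < δ → s.re = 1 / 2) :
    CofiniteCriticalLine := by
  unfold CofiniteCriticalLine
  refine (h4 δ hδ).subset ?_
  rintro s ⟨hz, h0, h1, hne⟩
  exact ⟨hz, h0, h1, not_lt.1 fun hlt => hne (hrep s hz h0 h1 hlt)⟩

/-- **Reading 1.** The glue rung `AsymptoticToCofinite` is exactly "rung #4 implies fixed-width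
repulsion from the critical line". [folklore] -/
theorem ruelleBand_asymptoticToCofinite_iff_lineRepulsion :
    AsymptoticToCofinite ↔
      (AsymptoticCriticalLine → ∃ δ : ℝ, 0 < δ ∧ ∀ s : ℂ, riemannZeta s = 0 → 0 < s.re → s.re < 1 →
        |s.re - 1 / 2| < δ → s.re = 1 / 2) := by
  unfold AsymptoticToCofinite
  refine ⟨fun h h4 => ruelleBand_lineRepulsion_of_cofiniteCriticalLine (h h4), fun h h4 => ?_⟩
  obtain ⟨δ, hδ, hrep⟩ := h h4
  exact ruelleBand_cofiniteCriticalLine_of_lineRepulsion h4 hδ hrep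

/-! ## 3. Eventual (high-height) repulsion suffices; the rate-versus-width race -/

/-- The zeros of `ζ` in the closed strip `0 ≤ Re s ≤ 1` of height `|Im s| ≤ T` form a finite set
(Mathlib `IsCompact.inter_riemannZetaZeros_finite` on the compact box `[0,1] × [-T,T]`). [folklore] -/
theorem ruelleBand_stripZeros_below_finite (T : ℝ) :
    {s : ℂ | riemannZeta s = 0 ∧ 0 < s.re ∧ s.re < 1 ∧ |s.im| ≤ T}.Finite := by
  refine (((isCompact_Icc (a := (0 : ℝ)) (b := 1)).reProdIm
    (isCompact_Icc (a := -T) (b := T))).inter_riemannZetaZeros_finite).subset ?_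
  rintro s ⟨hz, h0, h1, hT⟩
  exact ⟨Complex.mem_reProdIm.2 ⟨⟨h0.le, h1.le⟩, abs_le.1 hT⟩, hz⟩

/-- Repulsion at width `δ` ABOVE SOME HEIGHT `T` plus rung #4 at level `δ` gives rung #5: an off-line
zero is `δ`-far from the line (finitely many by rung #4) or of height `≤ T` (finitely many by
discreteness). [folklore] -/
theorem ruelleBand_cofiniteCriticalLine_of_eventualRepulsion (h4 : AsymptoticCriticalLine) {δ : ℝ}
    (hδ : 0 < δ) {T : ℝ}
    (hrep : ∀ s : ℂ, riemannZeta s = 0 → 0 < s.re → s.re < 1 → T < |s.im| →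
      |s.re - 1 / 2| < δ → s.re = 1 / 2) :
    CofiniteCriticalLine := by
  unfold CofiniteCriticalLine
  refine ((h4 δ hδ).union (ruelleBand_stripZeros_below_finite T)).subset ?_
  rintro s ⟨hz, h0, h1, hne⟩
  by_cases hlt : |s.re - 1 / 2| < δ
  · exact Or.inr ⟨hz, h0, h1, not_lt.1 fun hT => hne (hrep s hz h0 h1 hT hlt)⟩
  · exact Or.inl ⟨hz, h0, h1, not_lt.1 hlt⟩

/-- **Reading 2.** The glue rung is exactly "rung #4 implies repulsion from the line above some
height": `∃ δ > 0, ∃ T`, every zero of the open strip with `|Im s| > T` and `|Re s − 1/2| < δ` is on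
the line. [folklore] -/
theorem ruelleBand_asymptoticToCofinite_iff_eventualRepulsion :
    AsymptoticToCofinite ↔
      (AsymptoticCriticalLine → ∃ δ : ℝ, 0 < δ ∧ ∃ T : ℝ, ∀ s : ℂ, riemannZeta s = 0 → 0 < s.re →
        s.re < 1 → T < |s.im| → |s.re - 1 / 2| < δ → s.re = 1 / 2) := by
  refine ⟨fun h h4 => ?_, fun h h4 => ?_⟩
  · obtain ⟨δ, hδ, hrep⟩ := ruelleBand_asymptoticToCofinite_iff_lineRepulsion.1 h h4
    exact ⟨δ, hδ, 0, fun s hz h0 h1 _ hlt => hrep s hz h0 h1 hlt⟩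
  · obtain ⟨δ, hδ, T, hrep⟩ := h h4
    exact ruelleBand_cofiniteCriticalLine_of_eventualRepulsion h4 hδ hrep

/-- **The race.** If above some height `T₀` every zero of the open strip lies within `η(|Im s|)` of
the line (a concentration RATE — a quantitative rung #4) and every zero within `w(|Im s|)` of the line
is on it (a repulsion WIDTH), and the rate beats the width (`η T < w T` for `T > T₀`), then rung #5
holds: every off-line zero has height `≤ T₀`. Both inputs are open for `ζ`; the lemma only fixes
what a tube estimate must achieve. [folklore] -/
theorem ruelleBand_cofiniteCriticalLine_of_rate_lt_width {η w : ℝ → ℝ} {T₀ : ℝ}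
    (hrate : ∀ s : ℂ, riemannZeta s = 0 → 0 < s.re → s.re < 1 → T₀ < |s.im| →
      |s.re - 1 / 2| ≤ η |s.im|)
    (hwidth : ∀ s : ℂ, riemannZeta s = 0 → 0 < s.re → s.re < 1 → T₀ < |s.im| →
      |s.re - 1 / 2| < w |s.im| → s.re = 1 / 2)
    (hlt : ∀ T : ℝ, T₀ < T → η T < w T) :
    CofiniteCriticalLine := by
  unfold CofiniteCriticalLine
  refine (ruelleBand_stripZeros_below_finite T₀).subset ?_
  rintro s ⟨hz, h0, h1, hne⟩
  refine ⟨hz, h0, h1, not_lt.1 fun hT => hne (hwidth s hz h0 h1 hT ?_)⟩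
  exact (hrate s hz h0 h1 hT).trans_lt (hlt _ hT)

/-! ## 4. The failure shape -/

/-- The glue rung fails iff rung #4 holds with an INFINITE exceptional set. [folklore] -/
theorem ruelleBand_not_asymptoticToCofinite_iff :
    ¬ AsymptoticToCofinite ↔
      AsymptoticCriticalLine ∧
        {s : ℂ | riemannZeta s = 0 ∧ 0 < s.re ∧ s.re < 1 ∧ s.re ≠ 1 / 2}.Infinite := by
  unfold AsymptoticToCofinite CofiniteCriticalLine
  rw [Classical.not_imp]
  rfl

/-- If the glue rung fails, then for every `ε > 0` and every height `T` there is an off-line zero of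
the open strip within `ε` of the critical line and above height `T`: a counterexample is an infinite
family of off-line zeros converging to the line and escaping to infinite height. [folklore] -/
theorem ruelleBand_exists_offLine_near_line_above (h : ¬ AsymptoticToCofinite) {ε : ℝ} (hε : 0 < ε)
    (T : ℝ) :
    ∃ s : ℂ, riemannZeta s = 0 ∧ 0 < s.re ∧ s.re < 1 ∧ s.re ≠ 1 / 2 ∧ |s.re - 1 / 2| < ε ∧
      T < |s.im| := by
  obtain ⟨h4, hinf⟩ := ruelleBand_not_asymptoticToCofinite_iff.1 h
  by_contra hno
  push Not at hno
  refine hinf (((h4 ε hε).union (ruelleBand_stripZeros_below_finite T)).subset ?_)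
  rintro s ⟨hz, h0, h1, hne⟩
  by_cases hlt : |s.re - 1 / 2| < ε
  · exact Or.inr ⟨hz, h0, h1, hno s hz h0 h1 hne hlt⟩
  · exact Or.inl ⟨hz, h0, h1, not_lt.1 hlt⟩

/-- Conversely, such a family at ONE level `ε` already refutes the glue rung provided rung #4 holds:
infinitely many off-line zeros make the exceptional set infinite. (Without rung #4 an infinite
off-line family refutes rung #5 but says nothing about the implication.) [folklore] -/
theorem ruelleBand_not_asymptoticToCofinite_of_infinite (h4 : AsymptoticCriticalLine)
    (hinf : {s : ℂ | riemannZeta s = 0 ∧ 0 < s.re ∧ s.re < 1 ∧ s.re ≠ 1 / 2}.Infinite) :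
    ¬ AsymptoticToCofinite :=
  ruelleBand_not_asymptoticToCofinite_iff.2 ⟨h4, hinf⟩

end Summit.RiemannHypothesis.RiemannHypothesis.Theorems
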